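import Mathlib

/-!
# Clause 13-J/13-R, brick n3 LAYER D (GLUING ALGEBRA): the absorption step of the model estimate as pure real arithmetic

Route `FilamentSkeletonRss`, ∃-side clause 13 (`Clause13RNearStraightL` stmt-NavierStokesRegularity-23612; typing-agnostic); design
`filament-plan/DESIGN-28296-model-gluing-g16.md` §3 and v2 addendum §C (task C6).  The five landed piece estimates
(`model_piece_window_estimate` p701338 — pieces S1 / MID and the transition piece; `model_piece_band_estimate(_reflected)` p702355 / p702805 —
BAND±; `model_piece_low_estimate` p703208 — S0; `model_piece_far_estimate` p704476 + `l2_modelOperator_far_le` p704712 — FAR) all have the form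
«gain × ∫‖P_s‖² ≤ polynomial in the atoms `N(𝓛Y), N(Y), N((τ−c)Y), ‖Y‖₁` and the kernel constants».  With the ball facts `N((τ−c)Y) ≤ R·N(Y)` and
`‖Y‖₁ ≤ √(2R)·N(Y)` each becomes the COMMON SHAPE `∫‖P_s‖² ≤ α_s·N(𝓛Y)N(Y) + δ_s·N(Y)²` (§2: `window_piece_shape`, `band_piece_shape`,
`low_piece_shape`, `far_piece_shape` — the hypotheses are written so that the landed right-hand sides unify with them atom by atom), and
`N(Y)² ≤ 6Σ_s∫‖P_s‖²` closes to `N(Y) ≤ 12(Σα_s)·N(𝓛Y)` as soon as `6Σδ_s ≤ ½` (§1: `glue_absorb`).  No measure theory in this file: every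
symbol is a real number.
Lane ns-filament-19175-p1 g17; `--supports stmt-NavierStokesRegularity-23612 --as helper`.
HONEST FRAMING: arithmetic bookkeeping for helper lemmas about an explicit 1-D model operator attached to a HYPOTHETICAL filament skeleton on the
NEGATIVE side of a MODEL route; nothing here bears on Navier–Stokes regularity or blow-up.
-/

noncomputable section

namespace Summit.NavierStokesRegularity.NavierStokesRegularity.Theorems.MatchedKernel
set_option linter.dupNamespace false

/-! ## §1 Absorption -/

/-- **ABSORPTION.**  If `nY² ≤ 6(p₁+⋯+p₆)`, each `p_i ≤ α_i·nL·nY + δ_i·nY²`, and `6(δ₁+⋯+δ₆) ≤ ½`, then `nY ≤ 12(α₁+⋯+α₆)·nL`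
(`nY, nL ≥ 0`, `Σα ≥ 0`). [folklore] -/
theorem glue_absorb {nY nL p₁ p₂ p₃ p₄ p₅ p₆ α₁ α₂ α₃ α₄ α₅ α₆ δ₁ δ₂ δ₃ δ₄ δ₅ δ₆ : ℝ} (hY : 0 ≤ nY) (hL : 0 ≤ nL)
    (hsum : nY ^ 2 ≤ 6 * (p₁ + p₂ + p₃ + p₄ + p₅ + p₆))
    (h₁ : p₁ ≤ α₁ * (nL * nY) + δ₁ * nY ^ 2) (h₂ : p₂ ≤ α₂ * (nL * nY) + δ₂ * nY ^ 2) (h₃ : p₃ ≤ α₃ * (nL * nY) + δ₃ * nY ^ 2)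
    (h₄ : p₄ ≤ α₄ * (nL * nY) + δ₄ * nY ^ 2) (h₅ : p₅ ≤ α₅ * (nL * nY) + δ₅ * nY ^ 2) (h₆ : p₆ ≤ α₆ * (nL * nY) + δ₆ * nY ^ 2)
    (hα : 0 ≤ α₁ + α₂ + α₃ + α₄ + α₅ + α₆) (hδ : 6 * (δ₁ + δ₂ + δ₃ + δ₄ + δ₅ + δ₆) ≤ 1 / 2) :
    nY ≤ 12 * (α₁ + α₂ + α₃ + α₄ + α₅ + α₆) * nL := by
  set A : ℝ := α₁ + α₂ + α₃ + α₄ + α₅ + α₆ with hA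
  have hkey : nY ^ 2 ≤ 6 * A * (nL * nY) + (1 / 2) * nY ^ 2 := by
    have h1 : nY ^ 2 ≤ 6 * A * (nL * nY) + 6 * (δ₁ + δ₂ + δ₃ + δ₄ + δ₅ + δ₆) * nY ^ 2 := by
      rw [hA]; nlinarith [h₁, h₂, h₃, h₄, h₅, h₆, hsum]
    have h2 : 6 * (δ₁ + δ₂ + δ₃ + δ₄ + δ₅ + δ₆) * nY ^ 2 ≤ (1 / 2) * nY ^ 2 := mul_le_mul_of_nonneg_right hδ (sq_nonneg _)
    linarith
  have hkey' : nY * nY ≤ (12 * A * nL) * nY := by nlinarith [hkey]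
  rcases hY.lt_or_eq with hpos | hzero
  · exact le_of_mul_le_mul_right hkey' hpos
  · rw [← hzero]; positivity

/-! ## §2 The common shape of each piece estimate -/

/-- **WINDOW-TYPE PIECE (S1, MID, transition).**  From `Gκ·p ≤ (K·nL + C·nY + √2ΛK′·nW)·(K·nY)` (the right-hand side of
`model_piece_window_estimate`, `C = Λ(K′₁+K) + (L₁+L₂)K₁ + (b₁+b₂)K + √2ΛK′₁`) and `nW ≤ R·nY`:
`p ≤ (K²/(Gκ))·nL·nY + ((C + √2ΛK′R)K/(Gκ))·nY²`. [folklore] -/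
theorem window_piece_shape {G κ K K₁ K' K'₁ Λ L₁ L₂ b₁ b₂ R nY nL nW p : ℝ} (hG : 0 < G) (hκ : 0 < κ) (hK : 0 ≤ K) (hK' : 0 ≤ K')
    (hΛ : 0 ≤ Λ) (hY : 0 ≤ nY) (hW : nW ≤ R * nY)
    (h : G * κ * p ≤ (K * nL + (Λ * (K'₁ + K) + (L₁ + L₂) * K₁ + (b₁ + b₂) * K + Real.sqrt 2 * Λ * K'₁) * nY
        + Real.sqrt 2 * Λ * K' * nW) * (K * nY)) :
    p ≤ K ^ 2 / (G * κ) * (nL * nY)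
      + ((Λ * (K'₁ + K) + (L₁ + L₂) * K₁ + (b₁ + b₂) * K + Real.sqrt 2 * Λ * K'₁) + Real.sqrt 2 * Λ * K' * R) * K / (G * κ) * nY ^ 2 := by
  have hGκ : 0 < G * κ := mul_pos hG hκ
  set C : ℝ := Λ * (K'₁ + K) + (L₁ + L₂) * K₁ + (b₁ + b₂) * K + Real.sqrt 2 * Λ * K'₁ with hC
  have h1 : Real.sqrt 2 * Λ * K' * nW ≤ Real.sqrt 2 * Λ * K' * (R * nY) := mul_le_mul_of_nonneg_left hW (by positivity)
  have h2 : (K * nL + C * nY + Real.sqrt 2 * Λ * K' * nW) * (K * nY) ≤ (K * nL + C * nY + Real.sqrt 2 * Λ * K' * (R * nY)) * (K * nY) :=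
    mul_le_mul_of_nonneg_right (by linarith) (mul_nonneg hK hY)
  have h3 : G * κ * p ≤ K ^ 2 * (nL * nY) + (C + Real.sqrt 2 * Λ * K' * R) * K * nY ^ 2 := by
    refine (h.trans h2).trans (le_of_eq ?_); ring
  rw [div_mul_eq_mul_div, div_mul_eq_mul_div, ← add_div, le_div_iff₀ hGκ]
  linarith

/-- **BAND PIECE (either sign).**  From `G(σ₀/√q)·p ≤ (K·nL + C·nY)·√2(K·nW + K₁·nY)` (the right-hand side of `model_piece_band_estimate` /
`…_reflected`, `C = Λ(K′₁+K) + (L₁+L₂)K₁ + (Λ+b₁+3b₂)K ≥ 0`) and `nW ≤ R·nY`: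
`p ≤ (√q·√2(KR+K₁)K/(Gσ₀))·nL·nY + (√q·√2(KR+K₁)C/(Gσ₀))·nY²`. [folklore] -/
theorem band_piece_shape {G σ₀ q K K₁ C R nY nL nW p : ℝ} (hG : 0 < G) (hσ : 0 < σ₀) (hq : 0 < q) (hK : 0 ≤ K) (hC : 0 ≤ C)
    (hY : 0 ≤ nY) (hL : 0 ≤ nL) (hW : nW ≤ R * nY)
    (h : G * (σ₀ / √q) * p ≤ (K * nL + C * nY) * (Real.sqrt 2 * (K * nW + K₁ * nY))) :
    p ≤ √q * (Real.sqrt 2 * (K * R + K₁)) * K / (G * σ₀) * (nL * nY) + √q * (Real.sqrt 2 * (K * R + K₁)) * C / (G * σ₀) * nY ^ 2 := by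
  have hsq : 0 < √q := Real.sqrt_pos.2 hq
  have hg : 0 < G * (σ₀ / √q) := mul_pos hG (div_pos hσ hsq)
  have h1 : Real.sqrt 2 * (K * nW + K₁ * nY) ≤ Real.sqrt 2 * (K * R + K₁) * nY := by
    have : K * nW ≤ K * (R * nY) := mul_le_mul_of_nonneg_left hW hK
    nlinarith [Real.sqrt_nonneg 2]
  have h2 : (K * nL + C * nY) * (Real.sqrt 2 * (K * nW + K₁ * nY)) ≤ (K * nL + C * nY) * (Real.sqrt 2 * (K * R + K₁) * nY) :=
    mul_le_mul_of_nonneg_left h1 (by positivity)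
  have h3 : G * (σ₀ / √q) * p ≤ (Real.sqrt 2 * (K * R + K₁)) * K * (nL * nY) + (Real.sqrt 2 * (K * R + K₁)) * C * nY ^ 2 := by
    refine (h.trans h2).trans (le_of_eq ?_); ring
  have e : G * (σ₀ / √q) = G * σ₀ / √q := by ring
  rw [e, div_mul_eq_mul_div, div_le_iff₀ hsq] at h3
  rw [div_mul_eq_mul_div, div_mul_eq_mul_div, ← add_div, le_div_iff₀ (mul_pos hG hσ)]
  linarith

/-- **LOWEST PIECE (S0).**  From the right-hand side of `model_piece_low_estimate`
`p ≤ (θ/(π√q))(K·I₁)² + (q/θ²)·[(2/g)((K·nL + C·nY)(K·nY) + (b₁+b₂)(K²·nY²)) + (Λ²/g²)·2(K·nW + K₁·nY)²]` (`g = G·½log(1/a)`,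
`C = Λ(K′₁+K) + (L₁+L₂)K₁`, `I₁ = ‖Y‖₁`, `nY2 = ∫‖Y‖² = nY²`) and the ball facts `I₁ ≤ √(2R)·nY`, `nW ≤ R·nY`:
`p ≤ ((q/θ²)(2/g)K²)·nL·nY + ((θ/(π√q))K²(2R) + (q/θ²)((2/g)(CK + (b₁+b₂)K²) + (Λ²/g²)·2(KR+K₁)²))·nY²`. [folklore] -/
theorem low_piece_shape {q θ g K K₁ C Λ b₁ b₂ R nY nY2 nL nW I₁ p : ℝ} (hq : 0 < q) (hθ : 0 < θ) (hg : 0 < g) (hK : 0 ≤ K)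
    (hK₁ : 0 ≤ K₁) (hR : 0 ≤ R) (hY : 0 ≤ nY) (hY2 : nY2 = nY ^ 2) (hI₁ : 0 ≤ I₁) (hI : I₁ ≤ √(2 * R) * nY) (hW0 : 0 ≤ nW)
    (hW : nW ≤ R * nY)
    (h : p ≤ θ / (Real.pi * √q) * (K * I₁) ^ 2
        + q / θ ^ 2 * (2 / g * ((K * nL + C * nY) * (K * nY) + (b₁ + b₂) * (K ^ 2 * nY2)) + Λ ^ 2 / g ^ 2 * (2 * (K * nW + K₁ * nY) ^ 2))) :
    p ≤ q / θ ^ 2 * (2 / g) * K ^ 2 * (nL * nY)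
      + (θ / (Real.pi * √q) * K ^ 2 * (2 * R) + q / θ ^ 2 * (2 / g * (C * K + (b₁ + b₂) * K ^ 2) + Λ ^ 2 / g ^ 2 * (2 * (K * R + K₁) ^ 2))) * nY ^ 2 := by
  have hsq : 0 < √q := Real.sqrt_pos.2 hq
  subst hY2
  -- `(K I₁)² ≤ K²(2R) nY²`
  have h1 : (K * I₁) ^ 2 ≤ K ^ 2 * (2 * R) * nY ^ 2 := by
    have hKI : K * I₁ ≤ K * (√(2 * R) * nY) := mul_le_mul_of_nonneg_left hI hK
    have h0 : 0 ≤ K * I₁ := mul_nonneg hK hI₁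
    calc (K * I₁) ^ 2 ≤ (K * (√(2 * R) * nY)) ^ 2 := pow_le_pow_left₀ h0 hKI 2
      _ = K ^ 2 * (√(2 * R)) ^ 2 * nY ^ 2 := by ring
      _ = K ^ 2 * (2 * R) * nY ^ 2 := by rw [Real.sq_sqrt (by positivity)]
  -- `(K nW + K₁ nY)² ≤ (KR + K₁)² nY²`
  have h2 : (K * nW + K₁ * nY) ^ 2 ≤ (K * R + K₁) ^ 2 * nY ^ 2 := by
    have hle : K * nW + K₁ * nY ≤ (K * R + K₁) * nY := by nlinarith [mul_le_mul_of_nonneg_left hW hK]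
    have h0 : 0 ≤ K * nW + K₁ * nY := by positivity
    calc (K * nW + K₁ * nY) ^ 2 ≤ ((K * R + K₁) * nY) ^ 2 := pow_le_pow_left₀ h0 hle 2
      _ = (K * R + K₁) ^ 2 * nY ^ 2 := by ring
  have h3 : (K * nL + C * nY) * (K * nY) + (b₁ + b₂) * (K ^ 2 * nY ^ 2) = K ^ 2 * (nL * nY) + (C * K + (b₁ + b₂) * K ^ 2) * nY ^ 2 := by ring
  rw [h3] at h
  have hA : θ / (Real.pi * √q) * (K * I₁) ^ 2 ≤ θ / (Real.pi * √q) * (K ^ 2 * (2 * R) * nY ^ 2) :=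
    mul_le_mul_of_nonneg_left h1 (by positivity)
  have hB : Λ ^ 2 / g ^ 2 * (2 * (K * nW + K₁ * nY) ^ 2) ≤ Λ ^ 2 / g ^ 2 * (2 * ((K * R + K₁) ^ 2 * nY ^ 2)) :=
    mul_le_mul_of_nonneg_left (by linarith) (by positivity)
  have hq' : 0 ≤ q / θ ^ 2 := by positivity
  have hC : q / θ ^ 2 * (2 / g * (K ^ 2 * (nL * nY) + (C * K + (b₁ + b₂) * K ^ 2) * nY ^ 2) + Λ ^ 2 / g ^ 2 * (2 * (K * nW + K₁ * nY) ^ 2))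
      ≤ q / θ ^ 2 * (2 / g * (K ^ 2 * (nL * nY) + (C * K + (b₁ + b₂) * K ^ 2) * nY ^ 2) + Λ ^ 2 / g ^ 2 * (2 * ((K * R + K₁) ^ 2 * nY ^ 2))) :=
    mul_le_mul_of_nonneg_left (by linarith) hq'
  refine (h.trans (add_le_add hA hC)).trans (le_of_eq ?_)
  ring

/-- **`2·nT·nY ≤ nT²/η + η·nY²`** (the form of AM–GM used to price the transition piece without square roots). [folklore] -/
theorem two_mul_le_sq_div_add {nT nY η : ℝ} (hη : 0 < η) : 2 * (nT * nY) ≤ nT ^ 2 / η + η * nY ^ 2 := by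
  have h : 0 ≤ (nT - η * nY) ^ 2 / η := by positivity
  have e : (nT - η * nY) ^ 2 / η = nT ^ 2 / η + η * nY ^ 2 - 2 * (nT * nY) := by
    field_simp
    ring
  linarith [e ▸ h]

/-- **FAR PIECE.**  Inputs, all in the common atoms: the far estimate
`β₀(1−ε)²·pH ≤ (1+ε)·nH·((1+ε)·nLH + cH·nH + ℓ·Λ·nWH)` (right-hand side of `model_piece_far_estimate`), the reductions
`nH ≤ (1+K)nY` (`Y_H = Y − k∗Y`), `nWH ≤ RW·nY`, `nLH ≤ (1+K)nL + Λ·nT + CF·nY` (`l2_modelOperator_far_le`), and the common shape of the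
transition piece `pT = nT² ≤ αT·nL·nY + δT·nY²` (from `window_piece_shape`); a free `η > 0` prices `nT·nY` by `two_mul_le_sq_div_add`.  Output:
`pH ≤ αH·nL·nY + δH·nY²` with
`αH = (1+ε)²(1+K)((1+K) + Λ·αT/(2η))/(β₀(1−ε)²)`, `δH = ((1+ε)²(1+K)Λ(δT/(2η) + η/2) + (1+ε)(1+K)((1+ε)CF + cH(1+K) + ℓΛ·RW))/(β₀(1−ε)²)`.
[folklore] -/
theorem far_piece_shape {β₀ ε K Λ ℓ cH CF RW αT δT η nY nL nH nLH nWH nT pT pH : ℝ} (hβ₀ : 0 < β₀) (hε : 0 ≤ ε) (hε1 : ε < 1)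
    (hK : 0 ≤ K) (hΛ : 0 ≤ Λ) (hℓ : 0 ≤ ℓ) (hcH : 0 ≤ cH) (hCF : 0 ≤ CF) (hRW : 0 ≤ RW) (hη : 0 < η)
    (hY : 0 ≤ nY) (hL : 0 ≤ nL) (hH0 : 0 ≤ nH) (hT0 : 0 ≤ nT)
    (hH : nH ≤ (1 + K) * nY) (hWH : nWH ≤ RW * nY) (hLH : nLH ≤ (1 + K) * nL + Λ * nT + CF * nY)
    (hTsq : nT ^ 2 = pT) (hT : pT ≤ αT * (nL * nY) + δT * nY ^ 2)
    (h : β₀ * (1 - ε) ^ 2 * pH ≤ (1 + ε) * nH * ((1 + ε) * nLH + cH * nH + ℓ * Λ * nWH)) :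
    pH ≤ (1 + ε) ^ 2 * (1 + K) * ((1 + K) + Λ * αT / (2 * η)) / (β₀ * (1 - ε) ^ 2) * (nL * nY)
      + ((1 + ε) ^ 2 * (1 + K) * Λ * (δT / (2 * η) + η / 2) + (1 + ε) * (1 + K) * ((1 + ε) * CF + cH * (1 + K) + ℓ * Λ * RW))
          / (β₀ * (1 - ε) ^ 2) * nY ^ 2 := by
  have hgain : 0 < β₀ * (1 - ε) ^ 2 := mul_pos hβ₀ (pow_pos (by linarith) 2)
  have hε' : 0 ≤ 1 + ε := by linarith
  have hK' : 0 ≤ 1 + K := by linarith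
  -- the bracket is bounded using the reductions (each term is monotone in its atom)
  have hLH0 : (1 + ε) * nLH + cH * nH + ℓ * Λ * nWH ≤ (1 + ε) * ((1 + K) * nL + Λ * nT + CF * nY) + cH * ((1 + K) * nY) + ℓ * Λ * (RW * nY) := by
    have a := mul_le_mul_of_nonneg_left hLH hε'
    have b := mul_le_mul_of_nonneg_left hH hcH
    have c := mul_le_mul_of_nonneg_left hWH (mul_nonneg hℓ hΛ)
    linarith
  have hbr0 : 0 ≤ (1 + ε) * ((1 + K) * nL + Λ * nT + CF * nY) + cH * ((1 + K) * nY) + ℓ * Λ * (RW * nY) := by positivity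
  have h1 : (1 + ε) * nH * ((1 + ε) * nLH + cH * nH + ℓ * Λ * nWH)
      ≤ (1 + ε) * ((1 + K) * nY) * ((1 + ε) * ((1 + K) * nL + Λ * nT + CF * nY) + cH * ((1 + K) * nY) + ℓ * Λ * (RW * nY)) := by
    have hpre : (1 + ε) * nH * ((1 + ε) * nLH + cH * nH + ℓ * Λ * nWH)
        ≤ (1 + ε) * nH * ((1 + ε) * ((1 + K) * nL + Λ * nT + CF * nY) + cH * ((1 + K) * nY) + ℓ * Λ * (RW * nY)) :=
      mul_le_mul_of_nonneg_left hLH0 (mul_nonneg hε' hH0)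
    refine hpre.trans (mul_le_mul_of_nonneg_right (mul_le_mul_of_nonneg_left hH hε') hbr0)
  -- price `nT·nY`
  have h2 : nT * nY ≤ (αT * (nL * nY) + δT * nY ^ 2) / (2 * η) + η / 2 * nY ^ 2 := by
    have h3 := two_mul_le_sq_div_add (nT := nT) (nY := nY) hη
    have h4 : nT ^ 2 / η ≤ (αT * (nL * nY) + δT * nY ^ 2) / η := div_le_div_of_nonneg_right (hTsq ▸ hT) hη.le
    have e : (αT * (nL * nY) + δT * nY ^ 2) / (2 * η) = ((αT * (nL * nY) + δT * nY ^ 2) / η) / 2 := by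
      rw [div_div]; ring
    rw [e]
    linarith
  -- expand and collect
  have h5 : (1 + ε) * ((1 + K) * nY) * ((1 + ε) * ((1 + K) * nL + Λ * nT + CF * nY) + cH * ((1 + K) * nY) + ℓ * Λ * (RW * nY))
      = (1 + ε) ^ 2 * (1 + K) ^ 2 * (nL * nY) + (1 + ε) ^ 2 * (1 + K) * Λ * (nT * nY)
        + (1 + ε) * (1 + K) * ((1 + ε) * CF + cH * (1 + K) + ℓ * Λ * RW) * nY ^ 2 := by ring
  have hcoef : 0 ≤ (1 + ε) ^ 2 * (1 + K) * Λ := by positivity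
  have h6 : (1 + ε) ^ 2 * (1 + K) * Λ * (nT * nY)
      ≤ (1 + ε) ^ 2 * (1 + K) * Λ * ((αT * (nL * nY) + δT * nY ^ 2) / (2 * η) + η / 2 * nY ^ 2) := mul_le_mul_of_nonneg_left h2 hcoef
  have hmain : β₀ * (1 - ε) ^ 2 * pH ≤ (1 + ε) ^ 2 * (1 + K) * ((1 + K) + Λ * αT / (2 * η)) * (nL * nY)
      + ((1 + ε) ^ 2 * (1 + K) * Λ * (δT / (2 * η) + η / 2) + (1 + ε) * (1 + K) * ((1 + ε) * CF + cH * (1 + K) + ℓ * Λ * RW)) * nY ^ 2 := by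
    have h7 := (h.trans h1)
    rw [h5] at h7
    have e : (1 + ε) ^ 2 * (1 + K) * ((1 + K) + Λ * αT / (2 * η)) * (nL * nY)
        + ((1 + ε) ^ 2 * (1 + K) * Λ * (δT / (2 * η) + η / 2) + (1 + ε) * (1 + K) * ((1 + ε) * CF + cH * (1 + K) + ℓ * Λ * RW)) * nY ^ 2
        = (1 + ε) ^ 2 * (1 + K) ^ 2 * (nL * nY) + (1 + ε) ^ 2 * (1 + K) * Λ * ((αT * (nL * nY) + δT * nY ^ 2) / (2 * η) + η / 2 * nY ^ 2)
          + (1 + ε) * (1 + K) * ((1 + ε) * CF + cH * (1 + K) + ℓ * Λ * RW) * nY ^ 2 := by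
      field_simp
      ring
    rw [e]
    linarith
  rw [div_mul_eq_mul_div, div_mul_eq_mul_div, ← add_div, le_div_iff₀ hgain]
  linarith

/-! ## §3 Small reductions used by the gluing -/

/-- `N(Y_H) ≤ N(Y) + N(k∗Y) ≤ (1+K)·N(Y)`. [folklore] -/
theorem far_norm_le {nY nP nH K : ℝ} (hH : nH ≤ nY + nP) (hP : nP ≤ K * nY) : nH ≤ (1 + K) * nY := by linarith

/-- `N((τ−c)Y_H) ≤ N((τ−c)Y) + N((τ−c)(k∗Y)) ≤ (R + √2(KR + K₁))·N(Y)`. [folklore] -/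
theorem far_weight_le {nY nW nWP nWH K K₁ R : ℝ} (hK : 0 ≤ K) (hWH : nWH ≤ nW + nWP) (hW : nW ≤ R * nY)
    (hWP : nWP ≤ Real.sqrt 2 * (K * nW + K₁ * nY)) : nWH ≤ (R + Real.sqrt 2 * (K * R + K₁)) * nY := by
  have h1 : K * nW ≤ K * (R * nY) := mul_le_mul_of_nonneg_left hW hK
  nlinarith [Real.sqrt_nonneg 2]

/-- From `nY ≤ n₁+⋯+n₆` (Minkowski, `nY ≥ 0`): `nY² ≤ 6(n₁²+⋯+n₆²)` (Cauchy–Schwarz; the six-term inequality is the one of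
`Literature…HamiltonODE.sq_sum6_le`, inlined here to keep this file's imports to Mathlib). [folklore] -/
theorem sq_le_six_sum {nY n₁ n₂ n₃ n₄ n₅ n₆ : ℝ} (hY : 0 ≤ nY) (h : nY ≤ n₁ + n₂ + n₃ + n₄ + n₅ + n₆) :
    nY ^ 2 ≤ 6 * (n₁ ^ 2 + n₂ ^ 2 + n₃ ^ 2 + n₄ ^ 2 + n₅ ^ 2 + n₆ ^ 2) := by
  have hcs : (n₁ + n₂ + n₃ + n₄ + n₅ + n₆) ^ 2 ≤ 6 * (n₁ ^ 2 + n₂ ^ 2 + n₃ ^ 2 + n₄ ^ 2 + n₅ ^ 2 + n₆ ^ 2) := by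
    nlinarith [sq_nonneg (n₁ - n₂), sq_nonneg (n₁ - n₃), sq_nonneg (n₁ - n₄), sq_nonneg (n₁ - n₅), sq_nonneg (n₁ - n₆),
      sq_nonneg (n₂ - n₃), sq_nonneg (n₂ - n₄), sq_nonneg (n₂ - n₅), sq_nonneg (n₂ - n₆), sq_nonneg (n₃ - n₄), sq_nonneg (n₃ - n₅),
      sq_nonneg (n₃ - n₆), sq_nonneg (n₄ - n₅), sq_nonneg (n₄ - n₆), sq_nonneg (n₅ - n₆)]
  exact (pow_le_pow_left₀ hY h 2).trans hcs

end Summit.NavierStokesRegularity.NavierStokesRegularity.Theorems.MatchedKernel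

end
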